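import Summits.HubbardSuperconductivity.HubbardSuperconductivity.Theorems.AnisotropyChordSectorAnchorXYChemPotRP
import Literature.MathematicalPhysics.QuantumLattice.XYZGroundStateOrderGD

/-!
# Route `LevyLogBootstrap`, hub `HalfFilledOrder` (stmt-HubbardSuperconductivity-0906) — window, part 1:
# reflection positivity with a chemical potential for the easy-plane XXZ torus

For the spin-`n/2` ferro-XY / AF-Ising torus model
`H(Δ) = xxzHamiltonian n (torusGraph d L) (-1) Δ = -Σ_{⟨xy⟩}(SˣSˣ + SʸSʸ + Δ SᶻSᶻ)` on the even
torus (`L` even, `L ≥ 3`) with `Δ < 0`, a pair of reflection planes `P = (j, a)` with left half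
`Λ_L = torusLeftHalf L j a`, the magnetisation imbalance `X = S³_{Λ_L} - S³_{Λ ∖ Λ_L}` and the
total magnetisation `S³_tot`:

  `½ E₀(H(Δ) - μX) + ½ E₀(H(Δ) + μX) ≤ E₀(H(Δ) - μ S³_tot)`   (`xxz_groundEnergy_chemPot_reflect_le`),

the `Δ < 0` twin of `AnisotropyChord.groundEnergy_chemPot_reflect_le` (`Δ = 0`,
`Theorems/AnisotropyChordSectorAnchorXYChemPotRP.lean`). Proof: the Kennedy–Lieb–Shastry sublattice
rotation `W` (`π` about the `x`-axis on the odd sublattice, `exists_sublatticeRotation`) fixes the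
`SˣSˣ` bonds and flips `SʸSʸ`, `SᶻSᶻ` on every bond of the (bipartite) even torus and sends
`S³_x ↦ ε_x S³_x`; hence `W H(Δ) Wᴴ = H♭(0) + Δ Σ_⟨xy⟩ b²_{xy} = |Δ| · H'_{BU}(1/|Δ|, -1/|Δ|, 0)`,
Björnberg–Ueltschi's real field Hamiltonian at zero field (`xyzRealFieldHamiltonian`, couplings
`J₁ = s², J₂ = -s²`, `s² = 1/|Δ|`, `J₃ = 1`), whose Kronecker form along `θ`
(`xyzRealFieldHamiltonian_eq_submatrix`) makes `W(H(Δ) - μS³_tot)Wᴴ = K(|Δ|A - μq, |Δ|A + μq)` and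
`W(H(Δ) ∓ μX)Wᴴ = K(|Δ|A ∓ μq, |Δ|A ∓ μq)` with real crossing operators `√|Δ|·Mᵢ`; the abstract
ground-state reflection positivity `Matrix.kls_groundEnergy_reflection` concludes.
Kennedy–Lieb–Shastry, J. Stat. Phys. 53 (1988), eqs. (15)–(25); Dyson–Lieb–Simon (1978) Lemma 4.1;
Aizenman–Lieb–Seiringer–Solovej–Yngvason, PRA 70 (2004) 023612, App. A. No definition is introduced.
-/

-- the mandated namespace `Summit.<Summit>.<Problem>.Theorems` repeats `HubbardSuperconductivity`
set_option linter.dupNamespace false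

noncomputable section

namespace Summit.HubbardSuperconductivity.HubbardSuperconductivity.Theorems.LevyLogBootstrap

open Matrix Finset Literature.MathematicalPhysics.QuantumLattice Literature.Probability.LatticeModels
open Summit.HubbardSuperconductivity.HubbardSuperconductivity.Theorems.AnisotropyChord
  (exists_sublatticeRotation sum_compl_torusLeftHalf sum_univ_eq_sum_torusLeftHalf_add
    sum_torusLeftHalf_eq_sum_coe siteSpin_two_transpose)
open scoped ComplexOrder Kronecker

variable {d : ℕ}

/-! ### The XXZ torus as the XY torus plus Ising bonds -/

/-- `x + eⱼ` is the mirror image of `x` in the planes between the sites `xⱼ` and `xⱼ + 1`.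
[folklore] -/
theorem reflectBetweenSites_self_eq_add_single (L : ℕ) (j : Fin d) (x : TorusSite d L) :
    Torus.reflectBetweenSites j (x j) x = x + Pi.single j 1 := by
  funext l
  by_cases hl : l = j
  · subst hl
    rw [Torus.reflectBetweenSites_apply, Function.update_self, Pi.add_apply, Pi.single_eq_same]
    ring
  · rw [Torus.reflectBetweenSites_apply, Function.update_of_ne hl, Pi.add_apply,
      Pi.single_eq_of_ne hl, add_zero]

/-- **`H(Δ) = H(0) - Δ Σ_⟨xy⟩ b²_{xy}`**: the XXZ torus is the XY torus plus the Ising bonds.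
[folklore] -/
theorem xxzTorus_eq_xyTorus_sub (L : ℕ) [NeZero L] (n : ℕ) (Δ : ℝ) :
    xxzHamiltonian n (torusGraph d L) (-1) Δ =
      xyTorus d L n - (Δ : ℂ) • ∑ e ∈ (torusGraph d L).edgeFinset,
        Sym2.lift ⟨fun x y => spinBond n 2 x y, fun x y => spinBond_comm n 2 y x⟩ e := by
  rw [xyTorus, xxzHamiltonian, xxzHamiltonian, Finset.smul_sum, Finset.smul_sum, Finset.smul_sum,
    ← Finset.sum_sub_distrib]
  refine sum_congr rfl fun e _ => ?_
  induction e using Sym2.ind with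
  | h x y =>
    simp only [Sym2.lift_mk, Complex.ofReal_neg, Complex.ofReal_one, Complex.ofReal_zero, zero_smul,
      add_zero, smul_add, smul_smul, neg_one_mul, neg_smul]
    abel

/-! ### The sublattice rotation of the XXZ torus -/

/-- **The KLS sublattice rotation conjugates the XXZ torus into a scaled Björnberg–Ueltschi real
Hamiltonian**: for `Δ < 0` and `s = (-Δ)^{-1/2}`, with `W`, `ε` from `exists_sublatticeRotation`,
`W H(Δ) Wᴴ = (-Δ) · xyzRealFieldHamiltonian L n s² (-s²) 0` and `W S³_x Wᴴ = ε_x S³_x`.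
Kennedy–Lieb–Shastry (1988) eqs. (15)–(17). [folklore] -/
theorem exists_sublatticeRotation_xxz (k : ℕ) [NeZero (2 * k)] (n : ℕ) {Δ : ℝ} (hΔ : Δ < 0) :
    ∃ (W : Op (TorusSite d (2 * k)) (n + 1)) (sgn : TorusSite d (2 * k) → ℂ),
      W * Wᴴ = 1 ∧ Wᴴ * W = 1 ∧
      W * xxzHamiltonian n (torusGraph d (2 * k)) (-1) Δ * Wᴴ =
        ((-Δ : ℝ) : ℂ) • xyzRealFieldHamiltonian (2 * k) n (Real.sqrt (-Δ)⁻¹ ^ 2)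
          (-(Real.sqrt (-Δ)⁻¹ ^ 2)) 0 ∧
      (∀ x, W * siteSpin n x 2 * Wᴴ = sgn x • siteSpin n x 2) ∧
      (∀ x, sgn x = 1 ∨ sgn x = -1) ∧
      (∀ (j : Fin d) (a : ZMod (2 * k)) (x : TorusSite d (2 * k)),
        sgn (Torus.reflectBetweenSites j a x) = -sgn x) := by
  obtain ⟨W, sgn, hWW, hWW', hHW, hWz, hsgn1, hsgnθ⟩ := exists_sublatticeRotation (d := d) k n
  refine ⟨W, sgn, hWW, hWW', ?_, hWz, hsgn1, hsgnθ⟩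
  set E := (torusGraph d (2 * k)).edgeFinset with hE
  set t : ℝ := Real.sqrt (-Δ)⁻¹ ^ 2 with ht
  have ht' : t = (-Δ)⁻¹ := by rw [ht, Real.sq_sqrt (inv_nonneg.2 (by linarith))]
  have hΔt : -(Δ : ℂ) * (t : ℂ) = 1 := by
    rw [← Complex.ofReal_neg, ← Complex.ofReal_mul, ht', mul_inv_cancel₀ (by linarith),
      Complex.ofReal_one]
  -- signs of adjacent sites are opposite
  have hsq : ∀ x, sgn x * sgn x = 1 := by
    intro x
    rcases hsgn1 x with h | h <;> rw [h] <;> norm_num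
  have hedge : ∀ x y : TorusSite d (2 * k), (torusGraph d (2 * k)).Adj x y → sgn x * sgn y = -1 := by
    intro x y hxy
    rw [torusGraph_adj_iff] at hxy
    have key : ∀ (z : TorusSite d (2 * k)) (i : Fin d), sgn z * sgn (z + Pi.single i 1) = -1 := by
      intro z i
      rw [← reflectBetweenSites_self_eq_add_single (2 * k) i z, hsgnθ, mul_neg, hsq]
    obtain ⟨-, ⟨i, rfl⟩ | ⟨i, rfl⟩⟩ := hxy
    · exact key x i
    · rw [mul_comm]; exact key y i
  -- conjugation of the Ising bonds
  have hb2 : ∀ x y : TorusSite d (2 * k), (torusGraph d (2 * k)).Adj x y →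
      W * spinBond n 2 x y * Wᴴ = -spinBond n 2 x y := by
    intro x y hxy
    have hmul : ∀ A B : Op (TorusSite d (2 * k)) (n + 1),
        W * (A * B) * Wᴴ = (W * A * Wᴴ) * (W * B * Wᴴ) := by
      intro A B
      simp only [Matrix.mul_assoc]
      rw [← Matrix.mul_assoc Wᴴ W, hWW', Matrix.one_mul]
    have h2 : spinBond n 2 x y =
        (1 / 2 : ℂ) • (siteSpin n x 2 * siteSpin n y 2 + siteSpin n y 2 * siteSpin n x 2) := rfl
    rw [h2, Matrix.mul_smul, Matrix.smul_mul, Matrix.mul_add, Matrix.add_mul, hmul, hmul, hWz,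
      hWz, smul_mul_smul_comm, smul_mul_smul_comm, mul_comm (sgn y) (sgn x), hedge x y hxy,
      neg_one_smul, neg_one_smul, ← neg_add, smul_neg]
  -- `W H(Δ) Wᴴ = H♭(0) + Δ Σ b²`
  rw [xxzTorus_eq_xyTorus_sub, Matrix.mul_sub, Matrix.sub_mul, hHW, Matrix.mul_smul, Matrix.smul_mul,
    Finset.mul_sum, Finset.sum_mul, xyRealFieldHamiltonian, xyzRealFieldHamiltonian, ← hE,
    Finset.smul_sum, Finset.smul_sum, ← Finset.sum_sub_distrib]
  refine sum_congr rfl fun e he => ?_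
  induction e using Sym2.ind with
  | h x y =>
    have hxy : (torusGraph d (2 * k)).Adj x y := by
      rw [hE, SimpleGraph.mem_edgeFinset] at he
      exact he
    simp only [Sym2.lift_mk, hb2 x y hxy, xyRealBond, xyzRealBond, Pi.zero_apply, sub_self,
      Complex.ofReal_zero, zero_smul, sub_zero, ne_eq, OfNat.ofNat_ne_zero, not_false_eq_true,
      zero_pow, zero_div, add_zero, Complex.ofReal_neg, smul_sub, smul_neg, smul_smul, neg_smul]
    rw [hΔt]
    simp only [one_smul, sub_neg_eq_add]

/-! ### The chemical-potential reflection inequality -/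

section ChemPot

variable (L : ℕ) [NeZero L] (j : Fin d) (a : ZMod L) (n : ℕ)

/-- **Reflection positivity with a chemical potential for the easy-plane XXZ torus** (ground-state
form). For `H(Δ) = xxzHamiltonian n (torusGraph d L) (-1) Δ` with `Δ < 0` on the even torus of side
`L ≥ 3`, planes `P = (j, a)` with left half `Λ_L`, `X = S³_{Λ_L} - S³_{Λ∖Λ_L}` and every real `μ`:
`½ E₀(H - μX) + ½ E₀(H + μX) ≤ E₀(H - μ S³_tot)`. Kennedy–Lieb–Shastry, J. Stat. Phys. 53 (1988),
eqs. (20)–(25), with the one-body terms `∓μ ε_x S³_x` put into `A` and `B`; Dyson–Lieb–Simon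
(1978) Lemma 4.1; Aizenman–Lieb–Seiringer–Solovej–Yngvason (2004), App. A. [folklore] -/
theorem xxz_groundEnergy_chemPot_reflect_le (hL : Even L) (hL3 : 3 ≤ L) {Δ : ℝ} (hΔ : Δ < 0)
    (μ : ℝ) :
    ((xxzHamiltonian n (torusGraph d L) (-1) Δ - (μ : ℂ) • (∑ x ∈ torusLeftHalf L j a, siteSpin n x 2 -
          ∑ x ∈ (torusLeftHalf L j a)ᶜ, siteSpin n x 2)).groundEnergy +
        (xxzHamiltonian n (torusGraph d L) (-1) Δ + (μ : ℂ) •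
          (∑ x ∈ torusLeftHalf L j a, siteSpin n x 2 -
            ∑ x ∈ (torusLeftHalf L j a)ᶜ, siteSpin n x 2)).groundEnergy) / 2 ≤
      (xxzHamiltonian n (torusGraph d L) (-1) Δ - (μ : ℂ) • totalSpin n 2).groundEnergy := by
  obtain ⟨k, rfl⟩ : ∃ k, L = 2 * k := ⟨L / 2, by obtain ⟨k, hk⟩ := hL; omega⟩
  obtain ⟨W, sgn, hWW, hWW', hHW, hWz, hsgn1, hsgnθ⟩ :=
    exists_sublatticeRotation_xxz (d := d) k n hΔ
  have hU : W ∈ Matrix.unitaryGroup (TensorIndex (TorusSite d (2 * k)) (n + 1)) ℂ :=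
    Matrix.mem_unitaryGroup_iff.2 hWW
  -- abbreviations
  set s : ℝ := Real.sqrt (-Δ)⁻¹ with hs
  set c : ℝ := Real.sqrt (-Δ) with hc
  have hc2 : ((c : ℝ) : ℂ) * (c : ℂ) = ((-Δ : ℝ) : ℂ) := by
    rw [← Complex.ofReal_mul, hc, Real.mul_self_sqrt (by linarith)]
  set H : Op (TorusSite d (2 * k)) (n + 1) := xxzHamiltonian n (torusGraph d (2 * k)) (-1) Δ with hHdef
  set Λl := torusLeftHalf (2 * k) j a with hΛl
  set θ := Torus.reflectBetweenSites (d := d) (L := 2 * k) j a with hθ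
  set LE := torusLeftEmbed (q := n + 1) (2 * k) j a hL with hLE
  set RE := torusRightEmbed (q := n + 1) (2 * k) j a hL with hRE
  set e := torusSplit (q := n + 1) (2 * k) j a hL with he
  set A₀ := xyzLeftHamiltonian (2 * k) j a hL n (s ^ 2) (-(s ^ 2)) 0 with hA₀
  set M₀ := xyzCrossOp (2 * k) j a hL n s s 0 with hM₀
  obtain ⟨A, hA⟩ : ∃ A : Op (torusLeftHalf (2 * k) j a) (n + 1), A = ((-Δ : ℝ) : ℂ) • A₀ := ⟨_, rfl⟩
  obtain ⟨M, hM⟩ : ∃ M : torusCrossSites (2 * k) j a × Fin 3 → Op (torusLeftHalf (2 * k) j a) (n + 1),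
      M = fun i => ((c : ℝ) : ℂ) • M₀ i := ⟨_, rfl⟩
  set q : Op (torusLeftHalf (2 * k) j a) (n + 1) :=
    ∑ s : torusLeftHalf (2 * k) j a, sgn (s : TorusSite d (2 * k)) • siteSpin n s 2 with hq
  set X : Op (TorusSite d (2 * k)) (n + 1) :=
    ∑ x ∈ Λl, siteSpin n x 2 - ∑ x ∈ Λlᶜ, siteSpin n x 2 with hX
  set S : Op (TorusSite d (2 * k)) (n + 1) := totalSpin n 2 with hS
  -- (1) the Kronecker form of `W H Wᴴ`
  have hform : ∀ (B₁ B₂ : Op (torusLeftHalf (2 * k) j a) (n + 1))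
      (N : torusCrossSites (2 * k) j a × Fin 3 → Op (torusLeftHalf (2 * k) j a) (n + 1)),
      (B₁ ⊗ₖ 1 + 1 ⊗ₖ B₂ - ∑ i, N i ⊗ₖ N i).submatrix e e = LE B₁ + RE B₂ - ∑ i, LE (N i) * RE (N i) := by
    intro B₁ B₂ N
    rw [hLE, hRE, he]
    exact submatrix_kroneckerForm (2 * k) j a hL univ B₁ B₂ N N
  have hK0 : xyzRealFieldHamiltonian (2 * k) n (s ^ 2) (-(s ^ 2)) 0 =
      LE A₀ + RE A₀ - ∑ i, LE (M₀ i) * RE (M₀ i) := by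
    have h := xyzRealFieldHamiltonian_eq_submatrix (2 * k) j a hL n s s 0
    have h0 : (fun y => (0 : TorusSite d (2 * k) → ℝ) (Torus.reflectBetweenSites j a y)) =
        (0 : TorusSite d (2 * k) → ℝ) := rfl
    rw [h0] at h
    rw [h, ← hA₀, ← hM₀]
    exact hform A₀ A₀ M₀
  have hHW' : W * H * Wᴴ = LE A + RE A - ∑ i, LE (M i) * RE (M i) := by
    rw [hHW, hK0, smul_sub, smul_add, hA, map_smul, map_smul, Finset.smul_sum, hM]
    congr 1
    refine sum_congr rfl fun i _ => ?_
    rw [map_smul, map_smul, smul_mul_smul_comm, hc2]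
  -- (2) the rotated one-body terms: `W S³_tot Wᴴ = LE q - RE q`, `W X Wᴴ = LE q + RE q`
  have hleft : ∑ x ∈ Λl, sgn x • siteSpin n x 2 = LE q := by
    rw [hq, map_sum, ← sum_torusLeftHalf_eq_sum_coe (2 * k) j a hL]
    refine sum_congr rfl fun x hx => ?_
    rw [map_smul, torusToLeft_val_of_mem (2 * k) j a hL hx, hLE,
      ← siteSpin_eq_torusLeftEmbed n hx 2]
  have hright : ∑ x ∈ Λl, sgn (θ x) • siteSpin n (θ x) 2 = -RE q := by
    rw [hq, map_sum, ← Finset.sum_neg_distrib, ← sum_torusLeftHalf_eq_sum_coe (2 * k) j a hL]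
    refine sum_congr rfl fun x hx => ?_
    have hx' : θ x ∉ torusLeftHalf (2 * k) j a := fun h' =>
      (reflectBetweenSites_mem_torusLeftHalf_iff (2 * k) j a hL x).1 h' hx
    rw [map_smul, torusToLeft_val_of_mem (2 * k) j a hL hx, hRE,
      ← torusToLeft_reflectBetweenSites (2 * k) j a hL x, ← siteSpin_eq_torusRightEmbed n hx' 2,
      hθ, hsgnθ, neg_smul]
  have hWS : W * S * Wᴴ = LE q - RE q := by
    rw [hS, totalSpin, Finset.mul_sum, Finset.sum_mul,
      sum_univ_eq_sum_torusLeftHalf_add (2 * k) j a hL]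
    simp only [hWz]
    rw [hleft, hright, ← sub_eq_add_neg]
  have hWX : W * X * Wᴴ = LE q + RE q := by
    rw [hX, Matrix.mul_sub, Matrix.sub_mul, Finset.mul_sum, Finset.sum_mul, Finset.mul_sum,
      Finset.sum_mul, sum_compl_torusLeftHalf (2 * k) j a hL]
    simp only [hWz]
    rw [hleft, hright, sub_neg_eq_add]
  -- (3) the three rotated Hamiltonians as Kronecker forms
  have hqT : qᵀ = q := by
    rw [hq, transpose_sum]
    refine sum_congr rfl fun s _ => ?_
    rw [transpose_smul, siteSpin_two_transpose]
  have hA₀h : A₀.IsHermitian := xyzLeftHamiltonian_isHermitian (2 * k) j a n _ _ hL 0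
  have hA₀T : A₀ᵀ = A₀ := xyzLeftHamiltonian_transpose (2 * k) j a n _ _ hL 0
  have hAT : Aᵀ = A := by rw [hA, transpose_smul, hA₀T]
  have hAmT : (A - (μ : ℂ) • q)ᵀ = A - (μ : ℂ) • q := by rw [transpose_sub, hAT, transpose_smul, hqT]
  have hApT : (A + (μ : ℂ) • q)ᵀ = A + (μ : ℂ) • q := by rw [transpose_add, hAT, transpose_smul, hqT]
  have hMT : ∀ i, (M i)ᵀ = (M i)ᴴ := by
    intro i
    rw [hM]
    rw [transpose_smul, conjTranspose_smul, Complex.star_def, Complex.conj_ofReal]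
    congr 1
    exact xyzCrossOp_transpose_eq (2 * k) j a n hL s s 0 i
  have hKS : W * (H - (μ : ℂ) • S) * Wᴴ =
      ((A - (μ : ℂ) • q) ⊗ₖ 1 + 1 ⊗ₖ (A + (μ : ℂ) • q) - ∑ i, M i ⊗ₖ M i).submatrix e e := by
    rw [hform, Matrix.mul_sub, Matrix.sub_mul, hHW', Matrix.mul_smul, Matrix.smul_mul, hWS,
      map_sub, map_add, map_smul, map_smul, smul_sub]
    abel
  have hKm : W * (H - (μ : ℂ) • X) * Wᴴ =
      ((A - (μ : ℂ) • q) ⊗ₖ 1 + 1 ⊗ₖ (A - (μ : ℂ) • q) - ∑ i, M i ⊗ₖ M i).submatrix e e := by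
    rw [hform, Matrix.mul_sub, Matrix.sub_mul, hHW', Matrix.mul_smul, Matrix.smul_mul, hWX,
      map_sub, map_sub, map_smul, map_smul, smul_add]
    abel
  have hKp : W * (H + (μ : ℂ) • X) * Wᴴ =
      ((A + (μ : ℂ) • q) ⊗ₖ 1 + 1 ⊗ₖ (A + (μ : ℂ) • q) - ∑ i, M i ⊗ₖ M i).submatrix e e := by
    rw [hform, Matrix.mul_add, Matrix.add_mul, hHW', Matrix.mul_smul, Matrix.smul_mul, hWX,
      map_add, map_add, map_smul, map_smul, smul_add]
    abel
  -- (4) Hermiticity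
  have hSh : S.IsHermitian := totalSpin_isHermitian n 2
  have hXh : X.IsHermitian := by
    have hsum : ∀ t : Finset (TorusSite d (2 * k)),
        (∑ x ∈ t, (siteSpin n x 2 : Op (TorusSite d (2 * k)) (n + 1))).IsHermitian := by
      intro t
      rw [IsHermitian, conjTranspose_sum]
      exact sum_congr rfl fun x _ => (siteSpin_isHermitian n x 2).eq
    rw [hX]
    exact (hsum _).sub (hsum _)
  have hμ : ∀ {Y : Op (TorusSite d (2 * k)) (n + 1)}, Y.IsHermitian → ((μ : ℂ) • Y).IsHermitian := by
    intro Y hY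
    exact hY.smul (by rw [isSelfAdjoint_iff, Complex.star_def, Complex.conj_ofReal])
  have hHh : H.IsHermitian := xxzHamiltonian_isHermitian n _ (-1) Δ
  have hHSh : (H - (μ : ℂ) • S).IsHermitian := hHh.sub (hμ hSh)
  have hHmh : (H - (μ : ℂ) • X).IsHermitian := hHh.sub (hμ hXh)
  have hHph : (H + (μ : ℂ) • X).IsHermitian := hHh.add (hμ hXh)
  have herm : ∀ (Y : Op (TorusSite d (2 * k)) (n + 1)) (K : Matrix _ _ ℂ), Y.IsHermitian →
      W * Y * Wᴴ = K.submatrix e e → K.IsHermitian := by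
    intro Y K hY hf
    have : K = (W * Y * Wᴴ).submatrix e.symm e.symm := by
      rw [hf, submatrix_submatrix, Equiv.self_comp_symm, submatrix_id_id]
    rw [this]
    exact (isHermitian_mul_mul_conjTranspose W hY).submatrix _
  haveI : Nonempty ((torusLeftHalf (2 * k) j a → Fin (n + 1)) ×
      (torusLeftHalf (2 * k) j a → Fin (n + 1))) := ⟨(fun _ => 0, fun _ => 0)⟩
  -- (5) the abstract reflection positivity, transported back
  have hRP := Matrix.kls_groundEnergy_reflection (A - (μ : ℂ) • q) (A + (μ : ℂ) • q) M M hAmT hApT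
    hMT hMT (herm _ _ hHSh hKS) (herm _ _ hHmh hKm) (herm _ _ hHph hKp)
  rw [← Matrix.groundEnergy_submatrix_equiv (herm _ _ hHSh hKS) e,
    ← Matrix.groundEnergy_submatrix_equiv (herm _ _ hHmh hKm) e,
    ← Matrix.groundEnergy_submatrix_equiv (herm _ _ hHph hKp) e, ← hKS, ← hKm, ← hKp,
    Matrix.groundEnergy_unitary_conj hU, Matrix.groundEnergy_unitary_conj hU,
    Matrix.groundEnergy_unitary_conj hU] at hRP
  exact hRP

end ChemPot

end Summit.HubbardSuperconductivity.HubbardSuperconductivity.Theorems.LevyLogBootstrap
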